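import Summits.CriticalPhenomena.Ising3DConformalLimit.Theorems.SynchronousCouplingUniformRegularityMagneticRulerTransfer
import HarnessLib

/-!
# The attack object of line `Sketch` (magnetic ruler): ghost avoidance of the sourced current
# (crux `UniformRegularity`, stmt-CriticalPhenomena-4658, open stub `stub_excessPropagation`)

Route `SynchronousCoupling`. With `M(h) = ⟨σ₀⟩⁺_{β_c,h}` (`magnetizationInField 3 (criticalBeta 3) h`) and
`S_h(x) = ⟨σ₀σ_x⟩⁺_{β_c,h}` (`plusCorr 3 (criticalBeta 3) h {0, x}`), the GHOST-AVOIDANCE PROBABILITY of the pair `(0,x)` is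

  `A_h(x) := 1 − M(h)² / S_h(x) ∈ [0, 1)`.

Meaning (not formalised here, recorded for the next seat): by the switching lemma on `ℤ³ ∪ {ghost}`,
`M² = S_h(x) · P^{{0,x},∅}_h[0 ↔ g]`, so `A_h(x) = P^{{0,x},∅}_h[0 ↮ g]` is the probability that the (automatically connected)
cluster of the sources `0, x` of a double random current with sources `{0,x}` avoids the ghost; equivalently
`A_h(x) = ⟨σ₀;σ_x⟩_h / ⟨σ₀σ_x⟩_h`. In the FK representation with ghost, `⟨σ₀;σ_x⟩_h = φ(0 ↔ x off the ghost) + Cov(1_{0↔g}, 1_{x↔g})`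
and, given the lattice configuration, the lattice cluster `C ∋ 0` avoids the ghost with probability `2r/(1+r)`, `r = e^{−2β_c h |C|}`
(so the magnetic length `ℓ_h = (β_c h)^{−1/d_f}` is where `β_c h |C| ≍ 1` for a critical cluster of radius `ℓ_h`).

This file lands, over the transfer file (`uniformRegularity_iff_excessPropagation`, p159733), the algebra that makes `A_h` the attack
object of the open stub ECP (`stub_excessPropagation` of `Cruxes/UniformRegularity/Lines/Sketch.lean`):

* `sq_magnetization_le_plusCorr_pair` — `M(h)² ≤ S_h(x)` (`x ≠ 0`; GKS II in the limit, `plusCorr_mul_le` + translation invariance),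
  so `A_h(x)` is a genuine probability;
* `excessPropagation_of_ghostAvoidancePropagation` — **GHOST-AVOIDANCE PROPAGATION ⟹ ECP**: if for some `K ≥ 2`, `a ∈ (0,1)`,
  `h₀ > 0`, for all `0 < h < h₀`, `n ≥ 1` (inside the window `β_c n h M(h) ≤ 1`),
  `A_h(n e₀) ≥ 1 − 1/K ⟹ A_h(2n e₀) ≥ a`, then ECP holds with the same `K`, `κ = a` (indeed `S_h(2n e₀) ≥ M²/(1−a) ≥ (1+a)M²`);
* `ghostAvoidancePropagation_of_excessPropagation` — the converse (`a = κ/(1+κ)`), so the two are the SAME statement;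
* `excessPropagation_of_ghostAvoidanceSupermult` — **GHOST-AVOIDANCE SUPERMULTIPLICATIVITY ⟹ ECP**: if
  `∃ c > 0, h₀ > 0, ∀ h ∈ (0,h₀), ∀ n ≥ 1, c · A_h(n e₀)² ≤ A_h(2n e₀)` (GAS: "avoiding the ghost over the distance `2n` is at worst
  quadratically harder than over `n`" — the one-octave statement with a proof SHAPE: the two sources are born connected, no gluing),
  then ECP holds with `K = 2`, `κ = min c 1 / 4`; hence GAS ⟹ `UniformRegularity` (`uniformRegularity_of_ghostAvoidanceSupermult`).
  GAS is NOT claimed equivalent to the crux (deep in the massive regime it is an Ornstein–Zernike-type statement); it is recorded as the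
  line's sufficient condition with the cleanest attack surface.

References: Aizenman–Barsky–Fernández 1987 (currents with ghost) [AizenmanBarskyFernandez1987]; Fernández–Fröhlich–Sokal 1992 §12.4
(the kernel `K_h`, (12.126)–(12.131)) [FFS1992]; Aizenman–Duminil-Copin 2021 §5.6 [AizenmanDuminilCopinAnnals2021].
-/

noncomputable section

namespace Summit.CriticalPhenomena.Ising3DConformalLimit.Theorems.MagneticRuler

open scoped BigOperators Topology
open scoped symmDiff
open Filter Set
open Literature.Probability.LatticeModels

/-- **FKG/GKS II lower sandwich**: `M(h)² ≤ ⟨σ₀σ_x⟩⁺_{β,h}` for `β, h ≥ 0`, `x ≠ 0` on `ℤ³`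
(`plusCorr_mul_le` with `{0} ∆ {x} = {0,x}` and `⟨σ_x⟩⁺ = ⟨σ₀⟩⁺`). [FriedliVelenik2017 Thm 3.20] -/
theorem sq_magnetization_le_plusCorr_pair {β h : ℝ} (hβ : 0 ≤ β) (hh : 0 ≤ h) {x : Site 3} (hx : x ≠ 0) :
    magnetizationInField 3 β h ^ 2 ≤ plusCorr 3 β h {0, x} := by
  have h1 := plusCorr_mul_le (d := 3) hβ hh {0} {x}
  have hsd : ({0} : Finset (Site 3)) ∆ {x} = {0, x} := by
    ext y
    simp only [Finset.mem_symmDiff, Finset.mem_singleton, Finset.mem_insert]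
    constructor
    · rintro (⟨h0, -⟩ | ⟨hx', -⟩)
      · exact Or.inl h0
      · exact Or.inr hx'
    · rintro (h0 | hx')
      · exact Or.inl ⟨h0, fun h' => hx (h'.symm.trans h0)⟩
      · exact Or.inr ⟨hx', fun h' => hx (hx'.symm.trans h')⟩
  rw [hsd, StubGhsSandwich.plusCorr_singleton_eq_plusCorr_zero hβ hh x, ← magnetizationInField_eq_plusCorr] at h1
  simpa [sq] using h1

/-- Positivity of the field pair correlation at `β_c`: `0 < ⟨σ₀σ_x⟩⁺_{β_c,h}` for `h > 0`, `x ≠ 0` (it dominates `M(h)² > 0`). [folklore] -/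
theorem plusCorr_pair_pos {h : ℝ} (hh : 0 < h) {x : Site 3} (hx : x ≠ 0) :
    0 < plusCorr 3 (criticalBeta 3) h {0, x} :=
  lt_of_lt_of_le (pow_pos (stub_magnetizationRegular.2.2 h hh) 2)
    (sq_magnetization_le_plusCorr_pair (criticalBeta_nonneg 3) hh.le hx)

/-- **Ghost-avoidance propagation ⟹ ECP.** If `A_h(n e₀) ≥ 1 − 1/K` forces `A_h(2n e₀) ≥ a` (`K ≥ 2`, `0 < a < 1`, inside the
window), then `S_h(n e₀) ≥ K M² ⟹ S_h(2n e₀) ≥ (1+a) M²`, i.e. ECP with `κ = a`. [folklore] -/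
theorem excessPropagation_of_ghostAvoidancePropagation {K a h₀ : ℝ} (hK : 2 ≤ K) (ha : 0 < a) (ha1 : a < 1)
    (hh₀ : 0 < h₀)
    (hGAP : ∀ h ∈ Set.Ioo (0 : ℝ) h₀, ∀ n : ℕ, 1 ≤ n →
      criticalBeta 3 * ((n : ℝ) * h * magnetizationInField 3 (criticalBeta 3) h) ≤ 1 →
      1 - 1 / K ≤ 1 - magnetizationInField 3 (criticalBeta 3) h ^ 2 /
          plusCorr 3 (criticalBeta 3) h {0, Pi.single 0 (n : ℤ)} →
      a ≤ 1 - magnetizationInField 3 (criticalBeta 3) h ^ 2 /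
          plusCorr 3 (criticalBeta 3) h {0, Pi.single 0 (2 * (n : ℤ))}) :
    ∃ K κ h₀ : ℝ, 2 ≤ K ∧ 0 < κ ∧ 0 < h₀ ∧ ∀ h ∈ Set.Ioo (0 : ℝ) h₀, ∀ n : ℕ, 1 ≤ n →
      Literature.Probability.LatticeModels.criticalBeta 3 *
          ((n : ℝ) * h * Literature.Probability.LatticeModels.magnetizationInField 3
            (Literature.Probability.LatticeModels.criticalBeta 3) h) ≤ 1 →
      K * (Literature.Probability.LatticeModels.magnetizationInField 3
            (Literature.Probability.LatticeModels.criticalBeta 3) h) ^ 2 ≤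
        Literature.Probability.LatticeModels.plusCorr 3 (Literature.Probability.LatticeModels.criticalBeta 3) h
          {0, Pi.single 0 (n : ℤ)} →
      (1 + κ) * (Literature.Probability.LatticeModels.magnetizationInField 3
            (Literature.Probability.LatticeModels.criticalBeta 3) h) ^ 2 ≤
        Literature.Probability.LatticeModels.plusCorr 3 (Literature.Probability.LatticeModels.criticalBeta 3) h
          {0, Pi.single 0 (2 * (n : ℤ))} := by
  refine ⟨K, a, h₀, hK, ha, hh₀, fun h hh n hn hwin hhyp => ?_⟩
  set M := magnetizationInField 3 (criticalBeta 3) h with hMdef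
  set S₁ := plusCorr 3 (criticalBeta 3) h {0, Pi.single 0 (n : ℤ)} with hS₁
  set S₂ := plusCorr 3 (criticalBeta 3) h {0, Pi.single 0 (2 * (n : ℤ))} with hS₂
  have hKpos : 0 < K := by linarith
  have hn0 : (Pi.single 0 (n : ℤ) : Site 3) ≠ 0 := single_axis_ne_zero (by exact_mod_cast (by omega : n ≠ 0))
  have h2n0 : (Pi.single 0 (2 * (n : ℤ)) : Site 3) ≠ 0 :=
    single_axis_ne_zero (by exact_mod_cast (by omega : 2 * n ≠ 0))
  have hS₁pos : 0 < S₁ := plusCorr_pair_pos hh.1 hn0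
  have hS₂pos : 0 < S₂ := plusCorr_pair_pos hh.1 h2n0
  -- hypothesis in avoidance form: M²/S₁ ≤ 1/K
  have hA₁ : 1 - 1 / K ≤ 1 - M ^ 2 / S₁ := by
    have : M ^ 2 / S₁ ≤ 1 / K := by
      rw [div_le_div_iff₀ hS₁pos hKpos]; linarith
    linarith
  have hA₂ := hGAP h hh n hn hwin hA₁
  -- conclusion: M² ≤ (1 - a) S₂, hence (1 + a) M² ≤ S₂
  have h3 : M ^ 2 / S₂ ≤ 1 - a := by linarith
  rw [div_le_iff₀ hS₂pos] at h3
  have h4 : (1 + a) * M ^ 2 ≤ (1 + a) * ((1 - a) * S₂) := mul_le_mul_of_nonneg_left h3 (by linarith)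
  have h5 : (1 + a) * ((1 - a) * S₂) ≤ S₂ := by nlinarith [sq_nonneg a, hS₂pos.le]
  exact h4.trans h5

/-- **ECP ⟹ ghost-avoidance propagation** (`a = κ/(1+κ)`): the converse bookkeeping, so the two formulations coincide. [folklore] -/
theorem ghostAvoidancePropagation_of_excessPropagation {K κ h₀ : ℝ} (hκ : 0 < κ)
    (hECP : ∀ h ∈ Set.Ioo (0 : ℝ) h₀, ∀ n : ℕ, 1 ≤ n →
      criticalBeta 3 * ((n : ℝ) * h * magnetizationInField 3 (criticalBeta 3) h) ≤ 1 →
      K * magnetizationInField 3 (criticalBeta 3) h ^ 2 ≤ plusCorr 3 (criticalBeta 3) h {0, Pi.single 0 (n : ℤ)} →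
      (1 + κ) * magnetizationInField 3 (criticalBeta 3) h ^ 2 ≤
        plusCorr 3 (criticalBeta 3) h {0, Pi.single 0 (2 * (n : ℤ))}) :
    ∀ h ∈ Set.Ioo (0 : ℝ) h₀, ∀ n : ℕ, 1 ≤ n →
      criticalBeta 3 * ((n : ℝ) * h * magnetizationInField 3 (criticalBeta 3) h) ≤ 1 →
      1 - 1 / K ≤ 1 - magnetizationInField 3 (criticalBeta 3) h ^ 2 /
          plusCorr 3 (criticalBeta 3) h {0, Pi.single 0 (n : ℤ)} →
      0 < K →
      κ / (1 + κ) ≤ 1 - magnetizationInField 3 (criticalBeta 3) h ^ 2 /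
          plusCorr 3 (criticalBeta 3) h {0, Pi.single 0 (2 * (n : ℤ))} := by
  intro h hh n hn hwin hA₁ hKpos
  set M := magnetizationInField 3 (criticalBeta 3) h with hMdef
  set S₁ := plusCorr 3 (criticalBeta 3) h {0, Pi.single 0 (n : ℤ)} with hS₁
  set S₂ := plusCorr 3 (criticalBeta 3) h {0, Pi.single 0 (2 * (n : ℤ))} with hS₂
  have hn0 : (Pi.single 0 (n : ℤ) : Site 3) ≠ 0 := single_axis_ne_zero (by exact_mod_cast (by omega : n ≠ 0))
  have h2n0 : (Pi.single 0 (2 * (n : ℤ)) : Site 3) ≠ 0 :=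
    single_axis_ne_zero (by exact_mod_cast (by omega : 2 * n ≠ 0))
  have hS₁pos : 0 < S₁ := plusCorr_pair_pos hh.1 hn0
  have hS₂pos : 0 < S₂ := plusCorr_pair_pos hh.1 h2n0
  have hhyp : K * M ^ 2 ≤ S₁ := by
    have : M ^ 2 / S₁ ≤ 1 / K := by linarith
    rw [div_le_div_iff₀ hS₁pos hKpos] at this; linarith
  have hconc := hECP h hh n hn hwin hhyp
  -- M²/S₂ ≤ 1/(1+κ)
  have h1 : M ^ 2 / S₂ ≤ 1 / (1 + κ) := by
    rw [div_le_div_iff₀ hS₂pos (by linarith)]; linarith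
  have h2 : κ / (1 + κ) = 1 - 1 / (1 + κ) := by field_simp; ring
  rw [h2]; linarith

/-- **Ghost-avoidance supermultiplicativity (GAS) ⟹ ECP** with `K = 2`, `κ = min c 1 / 4`: from `c·A_h(n e₀)² ≤ A_h(2n e₀)` and
`A_h(n e₀) ≥ 1/2` one gets `A_h(2n e₀) ≥ c/4`. [folklore] -/
theorem excessPropagation_of_ghostAvoidanceSupermult {c h₀ : ℝ} (hc : 0 < c) (hh₀ : 0 < h₀)
    (hGAS : ∀ h ∈ Set.Ioo (0 : ℝ) h₀, ∀ n : ℕ, 1 ≤ n →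
      c * (1 - magnetizationInField 3 (criticalBeta 3) h ^ 2 /
          plusCorr 3 (criticalBeta 3) h {0, Pi.single 0 (n : ℤ)}) ^ 2 ≤
        1 - magnetizationInField 3 (criticalBeta 3) h ^ 2 /
          plusCorr 3 (criticalBeta 3) h {0, Pi.single 0 (2 * (n : ℤ))}) :
    ∃ K κ h₀ : ℝ, 2 ≤ K ∧ 0 < κ ∧ 0 < h₀ ∧ ∀ h ∈ Set.Ioo (0 : ℝ) h₀, ∀ n : ℕ, 1 ≤ n →
      Literature.Probability.LatticeModels.criticalBeta 3 *
          ((n : ℝ) * h * Literature.Probability.LatticeModels.magnetizationInField 3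
            (Literature.Probability.LatticeModels.criticalBeta 3) h) ≤ 1 →
      K * (Literature.Probability.LatticeModels.magnetizationInField 3
            (Literature.Probability.LatticeModels.criticalBeta 3) h) ^ 2 ≤
        Literature.Probability.LatticeModels.plusCorr 3 (Literature.Probability.LatticeModels.criticalBeta 3) h
          {0, Pi.single 0 (n : ℤ)} →
      (1 + κ) * (Literature.Probability.LatticeModels.magnetizationInField 3
            (Literature.Probability.LatticeModels.criticalBeta 3) h) ^ 2 ≤
        Literature.Probability.LatticeModels.plusCorr 3 (Literature.Probability.LatticeModels.criticalBeta 3) h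
          {0, Pi.single 0 (2 * (n : ℤ))} := by
  have hc' : 0 < min c 1 := lt_min hc one_pos
  refine excessPropagation_of_ghostAvoidancePropagation (K := 2) (a := min c 1 / 4) le_rfl (by positivity)
    (by have := min_le_right c 1; linarith) hh₀ fun h hh n hn _ hA₁ => ?_
  set A₁ := 1 - magnetizationInField 3 (criticalBeta 3) h ^ 2 /
      plusCorr 3 (criticalBeta 3) h {0, Pi.single 0 (n : ℤ)} with hA₁def
  have hhalf : 1 / 2 ≤ A₁ := by norm_num at hA₁ ⊢; linarith
  have hkey := hGAS h hh n hn
  have hsq : 1 / 4 ≤ A₁ ^ 2 := by nlinarith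
  calc min c 1 / 4 ≤ c * (1 / 4) := by have := min_le_left c 1; linarith
    _ ≤ c * A₁ ^ 2 := mul_le_mul_of_nonneg_left hsq hc.le
    _ ≤ _ := hkey

/-- **GAS ⟹ `UniformRegularity`** (route `SynchronousCoupling`): ghost-avoidance supermultiplicativity gives ECP, hence the crux by
the landed transfer `uniformRegularity_of_excessPropagation`. [folklore] -/
theorem uniformRegularity_of_ghostAvoidanceSupermult : ∀ {c h₀ : ℝ}, 0 < c → 0 < h₀ → (∀ h ∈ Set.Ioo (0 : ℝ) h₀, ∀ n : ℕ, 1 ≤ n → c * (1 - Literature.Probability.LatticeModels.magnetizationInField 3 (Literature.Probability.LatticeModels.criticalBeta 3) h ^ 2 / Literature.Probability.LatticeModels.plusCorr 3 (Literature.Probability.LatticeModels.criticalBeta 3) h {0, Pi.single 0 (n : ℤ)}) ^ 2 ≤ 1 - Literature.Probability.LatticeModels.magnetizationInField 3 (Literature.Probability.LatticeModels.criticalBeta 3) h ^ 2 / Literature.Probability.LatticeModels.plusCorr 3 (Literature.Probability.LatticeModels.criticalBeta 3) h {0, Pi.single 0 (2 * (n : ℤ))}) → Summit.CriticalPhenomena.Ising3DConformalLimit.Theses.SynchronousCoupling.UniformRegularity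 := by
  intro c h₀ hc hh₀ hGAS
  obtain ⟨K, κ, h₁, hK, hκ, hh₁, hE⟩ := excessPropagation_of_ghostAvoidanceSupermult hc hh₀ hGAS
  exact uniformRegularity_of_excessPropagation ⟨K, κ, h₁, hK, hκ, hh₁, hE⟩

end Summit.CriticalPhenomena.Ising3DConformalLimit.Theorems.MagneticRuler

end
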